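import Summits.BirchSwinnertonDyer.BirchSwinnertonDyer.Theorems.ThetaPartnerAtTwoSignedControlAtTwoPlusHondaTransport
import Summits.BirchSwinnertonDyer.BirchSwinnertonDyer.Theorems.ThetaPartnerAtTwoSignedControlAtTwoPlusGenZeroOfNonDiv
import HarnessLib

/-!
# Model transport for the plus Honda system at `2`, file 3: the NON-DIVISIBILITY form — HONDA⁺@2 (v6 stub
# `stub_plusHondaSystemTwo` of K4 `SignedControlAtTwo`, stmt-BirchSwinnertonDyer-20309, line `eulerchar`) over `ℚ_v` with (GEN₀)
# ⟸ over Mathlib's `ℚ_[2]`, for every embedding `ι`, the clauses (L) ∧ (TR) ∧ (GEN) ∧ «`d 0 ∉ 2·E(ℚ₂)`»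

Route `ThetaPartnerAtTwo` (TP2; crux shared with RTT), crux K4, line `eulerchar` v6 (8d2b4be25f391f24, lead
`prover-bsd-wall-tp2-p3` g2); seat `prover-bsd-wall-tp2-p3-w3` (width seat 3/3). Sequel of `…PlusHondaTransportEngine` (file 1),
`…PlusHondaTransport` (file 2) and `…PlusGenZeroOfNonDiv`.

WHY. The constructor of the Honda points (K3 lead, `…SignedKatoUpToAtTwoLocalTwoPlusPoints`, in the `ℚ_[2]` currency) proves at
level `0` the `2`-adic NON-DIVISIBILITY `d_0 ∉ 2·E(ℚ₂)` (a valuation statement: `log d_0 = −2/3`), not the generation clause (GEN₀);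
`…PlusGenZeroOfNonDiv` turns non-divisibility into (GEN₀) — but over the completion `ℚ_v` (Milne I 3.3 is typed there); and
`…PlusHondaTransport` moves a Honda system `ℚ_[2] → ℚ_v` — but with (GEN₀) on both sides. This file closes the square: transport the
NON-DIVISIBILITY form from (`ℚ_[p]`, every `ι`) to (`ℚ_v`, `closureEmb`) (§§1–2, any prime), then apply `hondaSystem_two_of_nonDiv`
at `ℚ_v` (§2, `p = 2`, good supersingular `W`).

WHAT.
* §1 (generic `K`, `Φ : Ē ≃ₐ[K] Ē'` over `φ : E ≃+* E'`, `ι' = Φ ∘ ι`, `T = Φ_*` given by `hT`) `nonDiv_modelTransport`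
  (`d₀ ∉ q·E(E)` ⟹ `T d₀ ∉ q·E(E')` on the layer-`0` points), `hondaSystemNonDiv_modelTransport` ((L) ∧ (TR) ∧ (GEN) ∧ (NONDIV)
  over (`E`, `ι`) ⟹ over (`E'`, `ι'`)).
* §2 (`K = ℚ`) `plusHondaSystemNonDiv_adicCompletion_of_padic` (any prime: the non-divisibility form over (`ℚ_[p]`, every `ι`) ⟹ over
  (`ℚ_v`, `closureEmb`)); **`plusHondaSystem_adicCompletion_of_padic_nonDiv`** (`p = 2`, `W` globally minimal with `GoodSS W 2`: the
  non-divisibility form over (`ℚ_[2]`, every `ι`) ⟹ HONDA⁺@2 with (GEN₀) over (`ℚ_v`, `closureEmb`) = the body of the stub); and the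
  sub-row form **`stub_plusHondaSystemTwo_of_padic_nonDiv`** whose conclusion is the registered v6 signature VERBATIM.
NET for the constructor: over Mathlib's `ℚ_[2]`, for every `ι : ℚ̄ → ℚ̄₂` and cyclotomic `κ`: points `d m ∈ localLayerPointsOfEmb κ ι W m`
with `Tr_{m+2/m+1} d_{m+2} = −d_m`, (GEN) for `m ≥ 1`, and `∀ b ∈ localLayerPointsOfEmb κ ι W 0, d 0 ≠ 2 • b`.

HONEST FRAMING: THEOREMS ONLY (no definition, no named fact, no instance, no `sorry`), route-independent (no `Theses` import);
closes nothing by itself; BSD is not proved by any of this.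

References: [SerreGaloisCohomology1997] J.-P. Serre, *Galois Cohomology*, II.§1.1; [Kobayashi2003] S. Kobayashi, Invent. Math. 152
(2003), Def. 1.1, §8.4 (Lemma 8.9, Prop. 8.11, Prop. 8.12); [MilneADT2006] J. S. Milne, *Arithmetic Duality Theorems*, I Lemma 3.3;
[MilneFT2022] J. S. Milne, *Fields and Galois Theory*, Ch. 6.
-/

set_option autoImplicit false
-- the Theorems namespace of this sub repeats the summit name by design (D-0017 nested layout)
set_option linter.dupNamespace false

noncomputable section

open scoped Classical NumberField

open NumberField IsDedekindDomain WeierstrassCurve Literature.NumberTheory.EllipticCurves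
  Literature.NumberTheory.EllipticCurves.Kobayashi2003
  Summit.BirchSwinnertonDyer.Rank1Residual.Additive.LocalTransport

universe u

namespace Summit.BirchSwinnertonDyer.BirchSwinnertonDyer.Theorems.SignedEC

/-! ## §1 Transport of the non-divisibility form (generic) -/

section Generic

variable {K : Type u} [Field K] {E : Type u} [Field E] [Algebra K E] {E' : Type u} [Field E'] [Algebra K E']
  (Φ : AlgebraicClosure E ≃ₐ[K] AlgebraicClosure E') (φ : E ≃+* E')
  (hf : ∀ y : E, Φ (algebraMap E (AlgebraicClosure E) y) = algebraMap E' (AlgebraicClosure E') (φ y))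
  (ι : AlgebraicClosure K →ₐ[K] AlgebraicClosure E) (ι' : AlgebraicClosure K →ₐ[K] AlgebraicClosure E')
  (hcompat : ∀ z : AlgebraicClosure K, ι' z = Φ (ι z))
  (W : WeierstrassCurve K) (T : localPoints W E →+ localPoints W E')
  (hT : ∀ P : localPoints W E, T P =
    WeierstrassCurve.Affine.Point.map (W' := W) (Φ : AlgebraicClosure E →ₐ[K] AlgebraicClosure E')
      (show (W.baseChange (AlgebraicClosure E)).toAffine.Point from P))
  {p : ℕ} [Fact p.Prime] (κ : ZpExtension K p)

include hf hcompat hT in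
/-- **Non-divisibility is transported**: if `d₀ ≠ q • b` for all layer-`0` points `b` over `E`, then `T d₀ ≠ q • b'` for all layer-`0`
points `b'` over `E'` (`T` is a bijection between the layer-`0` points and commutes with `q •`). [cite: SerreGaloisCohomology1997, II.§1.1] -/
theorem nonDiv_modelTransport (q : ℕ) {d₀ : localPoints W E}
    (hnd : ∀ b ∈ localLayerPointsOfEmb κ ι W 0, d₀ ≠ q • b) :
    ∀ b' ∈ localLayerPointsOfEmb κ ι' W 0, T d₀ ≠ q • b' := by
  intro b' hb' he
  obtain ⟨b, rfl⟩ := modelMap_surjective Φ W T hT b'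
  have hb : b ∈ localLayerPointsOfEmb κ ι W 0 :=
    (modelMap_mem_localLayerPointsOfEmb_iff Φ φ hf ι ι' hcompat W T hT κ 0 b).mp hb'
  refine hnd b hb ?_
  have hinj : Function.Injective T := fun P Q hPQ ↦ by
    rw [hT, hT] at hPQ
    exact WeierstrassCurve.Affine.Point.map_injective (W' := W) _ hPQ
  apply hinj
  rw [he, map_nsmul]

include hf hcompat hT in
/-- **A Honda system in NON-DIVISIBILITY form over (`E`, `ι`) yields one over (`E'`, `ι'`)** — clauses (L), (TR), (GEN) as in
`hondaSystem_modelTransport` and the fourth clause «`∀ b ∈ E(E), d 0 ≠ q • b`»; `d' := T ∘ d`.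
[cite: Kobayashi2003, Def. 1.1, §8.4] [cite: SerreGaloisCohomology1997, II.§1.1] -/
theorem hondaSystemNonDiv_modelTransport (q : ℕ)
    (h : ∃ d : ℕ → localPoints W E,
      (∀ m, d m ∈ localLayerPointsOfEmb κ ι W m) ∧
      (∀ m, localTraceOfEmb κ ι W (m + 1) (m + 2) (d (m + 2)) = -d m) ∧
      (∀ m : ℕ, 1 ≤ m → ∀ P ∈ localLayerPointsOfEmb κ ι W m,
        ∃ B ∈ AddSubgroup.closure (Set.range fun σ : Field.absoluteGaloisGroup E ↦ σ • d m),
          ∃ P' ∈ localLayerPointsOfEmb κ ι W (m - 1),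
          ∃ R ∈ localLayerPointsOfEmb κ ι W m, P = B + P' + q • R) ∧
      (∀ b ∈ localLayerPointsOfEmb κ ι W 0, d 0 ≠ q • b)) :
    ∃ d : ℕ → localPoints W E',
      (∀ m, d m ∈ localLayerPointsOfEmb κ ι' W m) ∧
      (∀ m, localTraceOfEmb κ ι' W (m + 1) (m + 2) (d (m + 2)) = -d m) ∧
      (∀ m : ℕ, 1 ≤ m → ∀ P ∈ localLayerPointsOfEmb κ ι' W m,
        ∃ B ∈ AddSubgroup.closure (Set.range fun σ : Field.absoluteGaloisGroup E' ↦ σ • d m),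
          ∃ P' ∈ localLayerPointsOfEmb κ ι' W (m - 1),
          ∃ R ∈ localLayerPointsOfEmb κ ι' W m, P = B + P' + q • R) ∧
      (∀ b ∈ localLayerPointsOfEmb κ ι' W 0, d 0 ≠ q • b) := by
  have hmem := modelMap_mem_localLayerPointsOfEmb_iff Φ φ hf ι ι' hcompat W T hT κ
  obtain ⟨d, hd, htr, hgen, hnd⟩ := h
  refine ⟨fun m ↦ T (d m), fun m ↦ (hmem m _).mpr (hd m), fun m ↦ ?_, fun m hm P' hP' ↦ ?_,
    nonDiv_modelTransport Φ φ hf ι ι' hcompat W T hT κ q hnd⟩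
  · rw [← modelMap_localTraceOfEmb Φ φ hf ι ι' hcompat W T hT κ (m + 1) (m + 2) (hd (m + 2)), htr, map_neg]
  · obtain ⟨P, rfl⟩ := modelMap_surjective Φ W T hT P'
    obtain ⟨B, hB, P₁, hP₁, R, hR, hPe⟩ := hgen m hm P ((hmem m P).mp hP')
    refine ⟨T B, ?_, T P₁, (hmem _ _).mpr hP₁, T R, (hmem _ _).mpr hR, by rw [hPe, map_add, map_add, map_nsmul]⟩
    rw [← map_modelMap_closure_orbit Φ φ hf W T hT]
    exact AddSubgroup.mem_map_of_mem T hB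

end Generic

/-! ## §2 `K = ℚ`: `ℚ_[p]` (every embedding) → `ℚ_v` (the chosen embedding), and the (GEN₀) form at `p = 2` -/

section Padic

open Rat.HeightOneSpectrum

/-- A finite place `v` of `ℚ` containing the rational prime `p` is the place of `p` (`primesEquiv v = p`). [folklore] -/
private theorem coe_primesEquiv_eq_of_natCast_mem_aux' {p : ℕ} [hp : Fact p.Prime] {v : HeightOneSpectrum (𝓞 ℚ)}
    (hpv : (p : 𝓞 ℚ) ∈ v.asIdeal) : ((primesEquiv v : Nat.Primes) : ℕ) = p := by
  have h : natGenerator v ∣ p := by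
    rw [natGenerator_dvd_iff, ← map_natCast (Rat.IsIntegralClosure.intEquiv (𝓞 ℚ)) p]
    exact Ideal.mem_map_of_mem _ hpv
  exact (Nat.prime_dvd_prime_iff_eq (prime_natGenerator v) hp.out).mp h

/-- **The model data at `v ∋ p`**: an isomorphism of algebraic closures `Φ : ℚ̄_p ≃ ℚ̄_v` over `ℚ` lying over a field isomorphism
`φ : ℚ_[p] ≃ ℚ_v` (Mathlib's `adicCompletion.padicEquiv`, `IsAlgClosure.equivOfEquiv`), together with an embedding `ι : ℚ̄ → ℚ̄_p` with
`closureEmb ℚ_v = Φ ∘ ι` (`ι := Φ⁻¹ ∘ closureEmb`). [cite: MilneFT2022, Ch. 6] [cite: SerreGaloisCohomology1997, II.§1.1] -/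
theorem exists_model_padic_adicCompletion {p : ℕ} [Fact p.Prime] {v : HeightOneSpectrum (𝓞 ℚ)} (hv : (p : 𝓞 ℚ) ∈ v.asIdeal) :
    ∃ (Φ : AlgebraicClosure ℚ_[p] ≃ₐ[ℚ] AlgebraicClosure (v.adicCompletion ℚ)) (φ : ℚ_[p] ≃+* v.adicCompletion ℚ),
      (∀ y : ℚ_[p], Φ (algebraMap ℚ_[p] (AlgebraicClosure ℚ_[p]) y) =
        algebraMap (v.adicCompletion ℚ) (AlgebraicClosure (v.adicCompletion ℚ)) (φ y)) ∧
      ∃ ι : AlgebraicClosure ℚ →ₐ[ℚ] AlgebraicClosure ℚ_[p], ∀ z, closureEmb (K := ℚ) (v.adicCompletion ℚ) z = Φ (ι z) := by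
  obtain rfl : ((primesEquiv v : Nat.Primes) : ℕ) = p := coe_primesEquiv_eq_of_natCast_mem_aux' hv
  let e : ℚ_[(primesEquiv v : ℕ)] ≃ₐ[ℚ] v.adicCompletion ℚ := (adicCompletion.padicEquiv v).toAlgEquiv.symm
  let Φr : AlgebraicClosure ℚ_[(primesEquiv v : ℕ)] ≃+* AlgebraicClosure (v.adicCompletion ℚ) :=
    IsAlgClosure.equivOfEquiv (AlgebraicClosure ℚ_[(primesEquiv v : ℕ)]) (AlgebraicClosure (v.adicCompletion ℚ)) e.toRingEquiv
  have hf : ∀ y, Φr (algebraMap ℚ_[(primesEquiv v : ℕ)] (AlgebraicClosure ℚ_[(primesEquiv v : ℕ)]) y) =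
      algebraMap (v.adicCompletion ℚ) (AlgebraicClosure (v.adicCompletion ℚ)) (e.toRingEquiv y) :=
    fun y ↦ IsAlgClosure.equivOfEquiv_algebraMap _ _ e.toRingEquiv y
  have hK : ∀ c : ℚ, Φr (algebraMap ℚ (AlgebraicClosure ℚ_[(primesEquiv v : ℕ)]) c) =
      algebraMap ℚ (AlgebraicClosure (v.adicCompletion ℚ)) c := by
    intro c
    rw [eq_ratCast (algebraMap ℚ (AlgebraicClosure ℚ_[(primesEquiv v : ℕ)])), eq_ratCast (algebraMap ℚ _), map_ratCast]
  let Φ : AlgebraicClosure ℚ_[(primesEquiv v : ℕ)] ≃ₐ[ℚ] AlgebraicClosure (v.adicCompletion ℚ) := { Φr with commutes' := hK }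
  refine ⟨Φ, e.toRingEquiv, fun y ↦ hf y,
    ((Φ.symm : AlgebraicClosure (v.adicCompletion ℚ) ≃ₐ[ℚ] AlgebraicClosure ℚ_[(primesEquiv v : ℕ)]) :
      AlgebraicClosure (v.adicCompletion ℚ) →ₐ[ℚ] AlgebraicClosure ℚ_[(primesEquiv v : ℕ)]).comp
      (closureEmb (K := ℚ) (v.adicCompletion ℚ)), fun z ↦ ?_⟩
  exact (Φ.apply_symm_apply _).symm

/-- **The non-divisibility form over (`ℚ_[p]`, every `ι`) ⟹ over (`ℚ_v`, `closureEmb`)** (any prime `p`, any `W/ℚ`, any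
`ℤ_p`-extension `κ`, `v ∋ p`). [cite: Kobayashi2003, Def. 1.1, §8.4] [cite: SerreGaloisCohomology1997, II.§1.1] -/
theorem plusHondaSystemNonDiv_adicCompletion_of_padic {p : ℕ} [Fact p.Prime] (W : WeierstrassCurve ℚ) (κ : ZpExtension ℚ p)
    (v : HeightOneSpectrum (𝓞 ℚ)) (hv : (p : 𝓞 ℚ) ∈ v.asIdeal)
    (h : ∀ ι : AlgebraicClosure ℚ →ₐ[ℚ] AlgebraicClosure ℚ_[p], ∃ d : ℕ → localPoints W ℚ_[p],
      (∀ m, d m ∈ localLayerPointsOfEmb κ ι W m) ∧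
      (∀ m, localTraceOfEmb κ ι W (m + 1) (m + 2) (d (m + 2)) = -d m) ∧
      (∀ m : ℕ, 1 ≤ m → ∀ P ∈ localLayerPointsOfEmb κ ι W m,
        ∃ B ∈ AddSubgroup.closure (Set.range fun σ : Field.absoluteGaloisGroup ℚ_[p] ↦ σ • d m),
          ∃ P' ∈ localLayerPointsOfEmb κ ι W (m - 1),
          ∃ R ∈ localLayerPointsOfEmb κ ι W m, P = B + P' + p • R) ∧
      (∀ b ∈ localLayerPointsOfEmb κ ι W 0, d 0 ≠ p • b)) :
    ∃ d : ℕ → localPoints W (v.adicCompletion ℚ),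
      (∀ m, d m ∈ localLayerPointsOfEmb κ (closureEmb (K := ℚ) (v.adicCompletion ℚ)) W m) ∧
      (∀ m, localTraceOfEmb κ (closureEmb (K := ℚ) (v.adicCompletion ℚ)) W (m + 1) (m + 2) (d (m + 2)) = -d m) ∧
      (∀ m : ℕ, 1 ≤ m → ∀ P ∈ localLayerPointsOfEmb κ (closureEmb (K := ℚ) (v.adicCompletion ℚ)) W m,
        ∃ B ∈ AddSubgroup.closure (Set.range fun σ : Field.absoluteGaloisGroup (v.adicCompletion ℚ) ↦ σ • d m),
          ∃ P' ∈ localLayerPointsOfEmb κ (closureEmb (K := ℚ) (v.adicCompletion ℚ)) W (m - 1),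
          ∃ R ∈ localLayerPointsOfEmb κ (closureEmb (K := ℚ) (v.adicCompletion ℚ)) W m, P = B + P' + p • R) ∧
      (∀ b ∈ localLayerPointsOfEmb κ (closureEmb (K := ℚ) (v.adicCompletion ℚ)) W 0, d 0 ≠ p • b) := by
  obtain ⟨Φ, φ, hf, ι, hcompat⟩ := exists_model_padic_adicCompletion (p := p) hv
  exact hondaSystemNonDiv_modelTransport Φ φ hf ι (closureEmb (K := ℚ) (v.adicCompletion ℚ)) hcompat W
    (show localPoints W ℚ_[p] →+ localPoints W (v.adicCompletion ℚ) from
      WeierstrassCurve.Affine.Point.map (W' := W) (Φ : AlgebraicClosure ℚ_[p] →ₐ[ℚ] AlgebraicClosure (v.adicCompletion ℚ)))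
    (fun _ ↦ rfl) κ p (h ι)

/-- **HONDA⁺@2 over (`ℚ_v`, `closureEmb`) — the body of the v6 stub `stub_plusHondaSystemTwo` at (`W`, `κ`, `v`) — from the
NON-DIVISIBILITY form over Mathlib's `ℚ_[2]` for every embedding `ι`**, for a globally minimal `W/ℚ` with `GoodSS W 2`: transport
(`plusHondaSystemNonDiv_adicCompletion_of_padic`) then (GEN₀) from non-divisibility at `ℚ_v` (`hondaSystem_two_of_nonDiv`, Milne I 3.3).
[cite: Kobayashi2003, §8.4 (Lemma 8.9, Prop. 8.11, Prop. 8.12)] [cite: MilneADT2006, I Lemma 3.3] [cite: SerreGaloisCohomology1997, II.§1.1] -/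
theorem plusHondaSystem_adicCompletion_of_padic_nonDiv (W : WeierstrassCurve ℚ) [W.IsElliptic] [W.IsGloballyMinimal]
    (hss : Rank1Residual.GoodSS W 2) (κ : ZpExtension ℚ 2) (v : HeightOneSpectrum (𝓞 ℚ)) (hv : (2 : 𝓞 ℚ) ∈ v.asIdeal)
    (h : ∀ ι : AlgebraicClosure ℚ →ₐ[ℚ] AlgebraicClosure ℚ_[2], ∃ d : ℕ → localPoints W ℚ_[2],
      (∀ m, d m ∈ localLayerPointsOfEmb κ ι W m) ∧
      (∀ m, localTraceOfEmb κ ι W (m + 1) (m + 2) (d (m + 2)) = -d m) ∧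
      (∀ m : ℕ, 1 ≤ m → ∀ P ∈ localLayerPointsOfEmb κ ι W m,
        ∃ B ∈ AddSubgroup.closure (Set.range fun σ : Field.absoluteGaloisGroup ℚ_[2] ↦ σ • d m),
          ∃ P' ∈ localLayerPointsOfEmb κ ι W (m - 1),
          ∃ R ∈ localLayerPointsOfEmb κ ι W m, P = B + P' + 2 • R) ∧
      (∀ b ∈ localLayerPointsOfEmb κ ι W 0, d 0 ≠ 2 • b)) :
    ∃ d : ℕ → localPoints W (v.adicCompletion ℚ),
      (∀ m, d m ∈ localLayerPointsOfEmb κ (closureEmb (K := ℚ) (v.adicCompletion ℚ)) W m) ∧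
      (∀ m, localTraceOfEmb κ (closureEmb (K := ℚ) (v.adicCompletion ℚ)) W (m + 1) (m + 2) (d (m + 2)) = -d m) ∧
      (∀ m : ℕ, 1 ≤ m → ∀ P ∈ localLayerPointsOfEmb κ (closureEmb (K := ℚ) (v.adicCompletion ℚ)) W m,
        ∃ B ∈ AddSubgroup.closure (Set.range fun σ : Field.absoluteGaloisGroup (v.adicCompletion ℚ) ↦ σ • d m),
          ∃ P' ∈ localLayerPointsOfEmb κ (closureEmb (K := ℚ) (v.adicCompletion ℚ)) W (m - 1),
          ∃ R ∈ localLayerPointsOfEmb κ (closureEmb (K := ℚ) (v.adicCompletion ℚ)) W m, P = B + P' + 2 • R) ∧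
      (∀ P ∈ localLayerPointsOfEmb κ (closureEmb (K := ℚ) (v.adicCompletion ℚ)) W 0,
        ∃ a : ℤ, ∃ R ∈ localLayerPointsOfEmb κ (closureEmb (K := ℚ) (v.adicCompletion ℚ)) W 0, P = a • d 0 + 2 • R) :=
  hondaSystem_two_of_nonDiv W hss κ v hv
    (plusHondaSystemNonDiv_adicCompletion_of_padic W κ v (by exact_mod_cast hv) h)

/-- **The v6 stub `stub_plusHondaSystemTwo` (HONDA⁺@2 over `ℚ_v`, `closureEmb`, with (GEN₀)) over the sub-row ⟸ the NON-DIVISIBILITY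
form over Mathlib's `ℚ_[2]` for EVERY embedding `ι`** — conclusion = the registered signature VERBATIM; hypothesis = what the K3/K4
construction delivers in the `ℚ_[2]` currency: layer points `d_m` with `Tr_{m+2/m+1} d_{m+2} = −d_m`, (GEN) for `m ≥ 1`, and
`d_0 ∉ 2·E(ℚ₂)`. [cite: Kobayashi2003, §8.4 (Lemma 8.9, Prop. 8.11, Prop. 8.12)] [cite: MilneADT2006, I Lemma 3.3] -/
theorem stub_plusHondaSystemTwo_of_padic_nonDiv
    (h : ∀ (W : WeierstrassCurve ℚ) [W.IsElliptic] [W.IsGloballyMinimal],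
      ¬ W.HasCM → W.analyticRank = 0 → Rank1Residual.GoodSS W 2 → W.frobeniusTrace 2 = 0 →
      ∀ (κ : ZpExtension ℚ 2), κ.IsCyclotomic →
      ∀ ι : AlgebraicClosure ℚ →ₐ[ℚ] AlgebraicClosure ℚ_[2], ∃ d : ℕ → localPoints W ℚ_[2],
        (∀ m, d m ∈ localLayerPointsOfEmb κ ι W m) ∧
        (∀ m, localTraceOfEmb κ ι W (m + 1) (m + 2) (d (m + 2)) = -d m) ∧
        (∀ m : ℕ, 1 ≤ m → ∀ P ∈ localLayerPointsOfEmb κ ι W m,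
          ∃ B ∈ AddSubgroup.closure (Set.range fun σ : Field.absoluteGaloisGroup ℚ_[2] ↦ σ • d m),
            ∃ P' ∈ localLayerPointsOfEmb κ ι W (m - 1),
            ∃ R ∈ localLayerPointsOfEmb κ ι W m, P = B + P' + 2 • R) ∧
        (∀ b ∈ localLayerPointsOfEmb κ ι W 0, d 0 ≠ 2 • b)) :
    ∀ (W : WeierstrassCurve ℚ) [W.IsElliptic] [W.IsGloballyMinimal],
      ¬ W.HasCM → W.analyticRank = 0 → Rank1Residual.GoodSS W 2 → W.frobeniusTrace 2 = 0 →
      ∀ (κ : ZpExtension ℚ 2), κ.IsCyclotomic →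
      ∀ (v : HeightOneSpectrum (𝓞 ℚ)), (2 : 𝓞 ℚ) ∈ v.asIdeal →
      ∃ d : ℕ → localPoints W (v.adicCompletion ℚ),
        (∀ m, d m ∈ localLayerPointsOfEmb κ (closureEmb (K := ℚ) (v.adicCompletion ℚ)) W m) ∧
        (∀ m, localTraceOfEmb κ (closureEmb (K := ℚ) (v.adicCompletion ℚ)) W (m + 1) (m + 2) (d (m + 2)) = -d m) ∧
        (∀ m : ℕ, 1 ≤ m → ∀ P ∈ localLayerPointsOfEmb κ (closureEmb (K := ℚ) (v.adicCompletion ℚ)) W m,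
          ∃ B ∈ AddSubgroup.closure (Set.range fun σ : Field.absoluteGaloisGroup (v.adicCompletion ℚ) ↦ σ • d m),
            ∃ P' ∈ localLayerPointsOfEmb κ (closureEmb (K := ℚ) (v.adicCompletion ℚ)) W (m - 1),
            ∃ R ∈ localLayerPointsOfEmb κ (closureEmb (K := ℚ) (v.adicCompletion ℚ)) W m, P = B + P' + 2 • R) ∧
        (∀ P ∈ localLayerPointsOfEmb κ (closureEmb (K := ℚ) (v.adicCompletion ℚ)) W 0,
          ∃ a : ℤ, ∃ R ∈ localLayerPointsOfEmb κ (closureEmb (K := ℚ) (v.adicCompletion ℚ)) W 0, P = a • d 0 + 2 • R) :=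
  fun W _ _ hcm hr hss ha κ hκ v hv ↦
    plusHondaSystem_adicCompletion_of_padic_nonDiv W hss κ v hv (h W hcm hr hss ha κ hκ)

end Padic

end Summit.BirchSwinnertonDyer.BirchSwinnertonDyer.Theorems.SignedEC

end
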